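import Summits.QuantumFields.YangMills.Theorems.UnitScaleTiltHalvingHSupURhoWindowsTop
import HarnessLib

/-!
# `hP1room` PROGRAMME (LEAD-H BOARD «H = hSupUρ3»), row (N05-WINDOWS) in the ρ3 LETTERS — PRELIMINARIES: budgets of the cubic smallness, the abstract
# (1.103) algebra, and the sizes of the (K-DE) letters `B₀' = 300·L·m₀·B₀'♭`, `σ = 2L·c⋆`, `δ = 40L·σ`, `ω = 3Lα₄/2`, `τ₀ = 16m₀σ`, `Cl`, `Cb`

Route `UnitScaleTilt`, crux K1 child «MinimiserStabilityRegPr» (stmt-QuantumFields-19200), registered stub `stub_halvingStep` (`BirthV10`).  Cell `ym3-torus`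
(HUMAN RULING D-0037: YM₃ on T³ is ladder rung R3 — NOT d = 4, NOT a mass gap, NOT the Clay problem); width seat `ym-t4-w13` g0; LEAD-H ★w5-19200 g5's τ₀ re-letter
(2026-08-28 17:27Z: the top target of ✓`P1FlatCoreTopBlocksAtMember.topTarget_of_reads` has `‖th‖ ≤ 16·m₀·Lᵏs₀`, `m₀ ≍ 3(M′+ρ′)`, `Lᵏs₀ ≍ c⋆` — second order in
`(ρ′+M′+1)`, hence `B₀'` carries `L·m₀` and the smallness is CUBIC).  `--supports stmt-QuantumFields-19200 --as helper`; THEOREMS ONLY (0 `def`, 0 `sorry`); PURE REAL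
ARITHMETIC, count-neutral; nothing here claims `hSiteRows`, `hSupUρ3`, the stub, the crux or the gap.  Consumer: `UnitScaleTiltHalvingHSupURhoWindowsRho3`.
Letters: `ℓ = L`, `n = ρ′+M′+1`, `s = n·ε₀`, `X₀ = 1+B₀+B₀⁻¹`, `Y = (1+B₀'H)(1+B₂')(1+BG)(1+BR)`, `V₄ = ℓ⁴X₀Y·n·s`, `Y′ = 400ℓ³nY` (the inflated letter at which the
landed `sizes`∕`second_order`∕`drops`∕`top106` of `…WindowsPrelim`∕`…WindowsTop` are re-read).

References: T. Bałaban, CMP **99** (1985) 75–102 [Balaban1985RegularSpaces] ((1.99)–(1.103) p.93, (1.106) p.94, Sect. E (1.120)–(1.125) pp.95–97, Thm 4 p.88).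
-/

set_option autoImplicit false

noncomputable section

namespace Summit.QuantumFields.YangMills.Theorems.HalvingHSupURhoWindowsRho3Prelim

open Literature.MathematicalPhysics.QuantumFieldTheory.Balaban1983to89
open B8Prop5ContractionKLevel (Mc mWc)

/-! ## §1 Budgets of the cubic smallness -/

set_option maxHeartbeats 400000 in
/-- **Budgets.**  From `10²⁹ℓ¹²X₀²Y⁵(1+c)·n²s ≤ 1` (`ℓ, X₀, Y, n ≥ 1`, `c, s ≥ 0`), with `Y′ := 400ℓ³nY`: the five budgets the landed `second_order`∕`drops`∕`top106` read at
`Y′`, and the direct ones `10²²ℓ¹⁰X₀²Y²n²s`, `10¹³ℓ⁵X₀Yns`, `10²¹ℓ⁶X₀Y²ns ≤ 1`, `s ≤ 1`. [cite: Balaban1985RegularSpaces, Thm 4 p.88] (elementary arithmetic; our proof) -/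
theorem budgets₃ {ℓ X₀ Y c n s : ℝ} (hℓ1 : 1 ≤ ℓ) (hX₀1 : 1 ≤ X₀) (hY1 : 1 ≤ Y) (hc0 : 0 ≤ c) (hn1 : 1 ≤ n) (hs0 : 0 ≤ s)
    (hW : (10 : ℝ) ^ 29 * ℓ ^ 12 * X₀ ^ 2 * Y ^ 5 * (1 + c) * (n ^ 2 * s) ≤ 1) :
    10 ^ 8 * ℓ ^ 2 * s ≤ 1 ∧ 10 ^ 12 * ℓ ^ 3 * X₀ ^ 2 * (400 * ℓ ^ 3 * n * Y) * (1 + c) * s ≤ 1 ∧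
      10 ^ 19 * ℓ ^ 4 * X₀ ^ 2 * (400 * ℓ ^ 3 * n * Y) ^ 2 * s ≤ 1 ∧ 10 ^ 23 * ℓ ^ 6 * X₀ ^ 2 * (400 * ℓ ^ 3 * n * Y) ^ 2 * s ≤ 1 ∧
      10 ^ 18 * Y ^ 4 * (ℓ ^ 3 * X₀ * (400 * ℓ ^ 3 * n * Y) * s) ≤ 1 ∧
      10 ^ 22 * ℓ ^ 10 * X₀ ^ 2 * Y ^ 2 * n ^ 2 * s ≤ 1 ∧ 10 ^ 13 * ℓ ^ 5 * X₀ * Y * n * s ≤ 1 ∧ 10 ^ 21 * ℓ ^ 6 * X₀ * Y ^ 2 * n * s ≤ 1 ∧ s ≤ 1 := by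
  have hX₀2 : 1 ≤ X₀ ^ 2 := one_le_pow₀ hX₀1
  have hY5 : 1 ≤ Y ^ 5 := one_le_pow₀ hY1
  have hℓ12 : 1 ≤ ℓ ^ 12 := one_le_pow₀ hℓ1
  have hn2 : 1 ≤ n ^ 2 := one_le_pow₀ hn1
  have hc1 : 1 ≤ 1 + c := by linarith only [hc0]
  have hM : (1 : ℝ) ≤ (10 : ℝ) ^ 29 * ℓ ^ 12 * X₀ ^ 2 * Y ^ 5 * (1 + c) * n ^ 2 := by
    calc (1 : ℝ) = 1 * 1 * 1 * 1 * 1 * 1 := by ring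
      _ ≤ (10 : ℝ) ^ 29 * ℓ ^ 12 * X₀ ^ 2 * Y ^ 5 * (1 + c) * n ^ 2 := by gcongr; norm_num
  have key : ∀ A : ℝ, A ≤ (10 : ℝ) ^ 29 * ℓ ^ 12 * X₀ ^ 2 * Y ^ 5 * (1 + c) * n ^ 2 → A * s ≤ 1 := by
    intro A hA
    have := mul_le_mul_of_nonneg_right hA hs0
    linarith only [this, hW]
  refine ⟨?_, ?_, ?_, ?_, ?_, ?_, ?_, ?_, ?_⟩
  · refine key _ ?_
    calc (10 : ℝ) ^ 8 * ℓ ^ 2 = (10 : ℝ) ^ 8 * ℓ ^ 2 * 1 * 1 * 1 * 1 := by ring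
      _ ≤ (10 : ℝ) ^ 29 * ℓ ^ 12 * X₀ ^ 2 * Y ^ 5 * (1 + c) * n ^ 2 := by gcongr <;> norm_num
  · have h : 10 ^ 12 * ℓ ^ 3 * X₀ ^ 2 * (400 * ℓ ^ 3 * n * Y) * (1 + c) * s = (4 * 10 ^ 14 * ℓ ^ 6 * X₀ ^ 2 * Y ^ 1 * (1 + c) * n ^ 1) * s := by ring
    rw [h]; refine key _ ?_; gcongr <;> norm_num
  · have h : 10 ^ 19 * ℓ ^ 4 * X₀ ^ 2 * (400 * ℓ ^ 3 * n * Y) ^ 2 * s = (16 * 10 ^ 23 * ℓ ^ 10 * X₀ ^ 2 * Y ^ 2 * 1 * n ^ 2) * s := by ring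
    rw [h]; refine key _ ?_; gcongr <;> norm_num
  · have h : 10 ^ 23 * ℓ ^ 6 * X₀ ^ 2 * (400 * ℓ ^ 3 * n * Y) ^ 2 * s = (16 * 10 ^ 27 * ℓ ^ 12 * X₀ ^ 2 * Y ^ 2 * 1 * n ^ 2) * s := by ring
    rw [h]; refine key _ ?_; gcongr <;> norm_num
  · have h : 10 ^ 18 * Y ^ 4 * (ℓ ^ 3 * X₀ * (400 * ℓ ^ 3 * n * Y) * s) = (4 * 10 ^ 20 * ℓ ^ 6 * X₀ ^ 1 * Y ^ 5 * 1 * n ^ 1) * s := by ring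
    rw [h]; refine key _ ?_; gcongr <;> norm_num
  · have h : 10 ^ 22 * ℓ ^ 10 * X₀ ^ 2 * Y ^ 2 * n ^ 2 * s = (10 ^ 22 * ℓ ^ 10 * X₀ ^ 2 * Y ^ 2 * 1 * n ^ 2) * s := by ring
    rw [h]; refine key _ ?_; gcongr <;> norm_num
  · have h : 10 ^ 13 * ℓ ^ 5 * X₀ * Y * n * s = (10 ^ 13 * ℓ ^ 5 * X₀ ^ 1 * Y ^ 1 * 1 * n ^ 1) * s := by ring
    rw [h]; refine key _ ?_; gcongr <;> norm_num
  · have h : 10 ^ 21 * ℓ ^ 6 * X₀ * Y ^ 2 * n * s = (10 ^ 21 * ℓ ^ 6 * X₀ ^ 1 * Y ^ 2 * 1 * n ^ 1) * s := by ring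
    rw [h]; refine key _ ?_; gcongr <;> norm_num
  · have := key 1 hM; linarith only [this]

/-! ## §2 (1.103), abstract form -/

set_option maxHeartbeats 400000 in
/-- **(1.103) `B_G·M ≤ α₄/4` from four share inequalities** (`b₁ := α₄/4 + B₀'H(Cb+τ)`, `mE := B₂'(Cb+τ)`): the cDA share `≤ α₄/40`, the `B₂'τ` share `≤ α₄/150`, the
`B₂'Cb` share `≤ α₄/64` (all three supplied by the caller — structural floors of `B₀'`, or smallness), and the quadratic share by `10¹¹Y(120cB+8α₄) ≤ 1`.
[cite: Balaban1985RegularSpaces, (1.103) p.93, (1.99) p.93] (elementary arithmetic; our proof) -/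
theorem top103₃ {BG BR B₂' B₀'H Y α₄ cB cDA Cb τ : ℝ}
    (hBG : 0 ≤ BG) (hBR : 0 ≤ BR) (hB₀'H : 0 < B₀'H) (hY0 : 0 ≤ Y) (hBGBRY : BG * BR ≤ Y)
    (hα₄0 : 0 < α₄) (hcB0 : 0 ≤ cB) (hCb0 : 0 ≤ Cb) (hCbρ' : 2 * B₀'H * Cb ≤ α₄)
    (h1 : BG * BR * cDA ≤ α₄ / 40) (h2 : BG * BR * (B₂' * τ) ≤ α₄ / 150) (h3 : BG * BR * (B₂' * Cb) ≤ α₄ / 64)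
    (hQY : 10 ^ 11 * Y * (120 * cB + 8 * α₄) ≤ 1) (hτ0 : 0 ≤ τ) (hBτ : B₀'H * τ ≤ α₄ / 4) :
    BG * Mc 3 BR (α₄ / 4 + B₀'H * (Cb + τ)) cB (B₂' * (Cb + τ)) cDA ≤ α₄ / 4 := by
  have hBGBR : 0 ≤ BG * BR := mul_nonneg hBG hBR
  rw [Mc, mWc]; push_cast
  set b₁ : ℝ := α₄ / 4 + B₀'H * (Cb + τ) with hb₁
  have hb10 : 0 ≤ b₁ := by positivity
  have hb1U : b₁ ≤ α₄ := by rw [hb₁]; linarith only [hCbρ', hBτ]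
  have h4 : BG * BR * (3 * (82 * b₁ ^ 2 + 34 * cB * b₁)) ≤ α₄ / 32 := by
    rw [le_div_iff₀ (by norm_num : (0 : ℝ) < 32)]
    have hb : 82 * b₁ ^ 2 + 34 * cB * b₁ ≤ (82 * α₄ + 34 * cB) * α₄ := by
      nlinarith only [mul_le_mul hb1U hb1U hb10 hα₄0.le, mul_le_mul_of_nonneg_left hb1U hcB0]
    have hY' : 82 * α₄ + 34 * cB ≤ 11 * (120 * cB + 8 * α₄) := by linarith only [hα₄0, hcB0]
    have hc := mul_le_mul hBGBRY hY' (by positivity) hY0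
    have e := mul_le_mul_of_nonneg_left hb hBGBR
    have e' := mul_le_mul_of_nonneg_right (hc.trans (by linarith only [hQY] : Y * (11 * (120 * cB + 8 * α₄)) ≤ 1 / 96)) hα₄0.le
    linarith only [e, e']
  have hsum : BG * (BR * (2 * (6 / 5 * cDA + 2 * (B₂' * (Cb + τ)) + 3 * (82 * b₁ ^ 2 + 34 * cB * b₁)))) =
      2 * (6 / 5 * (BG * BR * cDA) + 2 * (BG * BR * (B₂' * Cb)) + 2 * (BG * BR * (B₂' * τ)) + BG * BR * (3 * (82 * b₁ ^ 2 + 34 * cB * b₁))) := by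
    ring
  rw [hsum]; linarith only [h1, h2, h3, h4, hα₄0]

/-! ## §3 Sizes of the ρ3 letters -/

set_option maxHeartbeats 400000 in
/-- **Sizes of the (K-DE) letters** against `V₄ := ℓ⁴X₀Y·n·s`: `B₀' = 300ℓm₀B₀'♭` (`1 ≤ m₀ ≤ 3n`), `α₄ = 8B₀'c⋆ = 2400ℓm₀B₀'♭c⋆ ≤ 4·10⁸V₄`, `σ = 2ℓ(c⋆ + a₆₆)`
(`a₆₆ ≤ 198s ≤ c⋆/2`), `δ = 40ℓσ`, `ω = 3ℓα₄/2`, `τ₀ = 16m₀σ = 32ℓm₀(c⋆ + a₆₆)`, `t, Q ≤ 4·10⁹V₄`, `Cl ≤ 10¹⁸ℓ²V₄`, `Cb₂ = 640(α₄+δ+5ω)ω ≤ 4·10²¹ℓ²V₄²`, and the three STRUCTURAL shares of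
(1.103) from the floors of `B₀'♭`. [cite: Balaban1985RegularSpaces, (1.103) p.93, Sect. E (1.120)-(1.125) pp.95-97] (elementary arithmetic; our proof) -/
theorem letters₃ {ℓ X₀ Y BG BR B₂' B₀'H n s ε₀ m a cstar B₀'b B₀' α₄ σ δ ω τ₀ cB cDA Cl Cb₂ : ℝ}
    (hℓ1 : 1 ≤ ℓ) (hX₀1 : 1 ≤ X₀) (hY1 : 1 ≤ Y) (hBG : 0 ≤ BG) (hBR : 0 ≤ BR) (hB₂' : 0 ≤ B₂') (hB₀'H : 0 < B₀'H)
    (hn1 : 1 ≤ n) (hs0 : 0 < s) (hεs : ε₀ ≤ s) (hm1 : 1 ≤ m) (hm3 : m ≤ 3 * n)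
    (ha0 : 0 ≤ a) (haU : a ≤ 198 * s) (hcs0 : 0 < cstar) (hcsL : 405 * s ≤ cstar) (hcsU : cstar ≤ 3390 * ℓ * X₀ * s)
    (hb0 : 0 < B₀'b) (hbU : B₀'b ≤ 15 * ℓ ^ 2 * Y) (hbL1 : B₀'H ≤ B₀'b) (hbL2 : 15 * ℓ ^ 2 * BG * BR ≤ B₀'b) (hbL3 : 3 * BG * BR * B₂' ≤ B₀'b)
    (hB₀' : B₀' = 300 * ℓ * m * B₀'b) (hα₄ : α₄ = 8 * B₀' * cstar) (hσ : σ = 2 * ℓ * (cstar + a)) (hδ : δ = 40 * ℓ * σ) (hω : ω = 3 * ℓ * α₄ / 2)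
    (hτ₀ : τ₀ = 16 * m * σ) (hcB : cB = ℓ * cstar) (hcDA : cDA = 3 * ℓ ^ 2 * cstar)
    (hCl : Cl = 2 * 579944448 * (120 * cB + 2 * α₄) + 10240 * (3 * ℓ) * (α₄ + δ + 11 * ω)) (hCb₂ : Cb₂ = 640 * (α₄ + δ + 5 * ω) * ω) :
    0 < B₀' ∧ B₀'H ≤ B₀' ∧ 0 < α₄ ∧ α₄ ≤ 4 * 10 ^ 8 * (ℓ ^ 4 * X₀ * Y * n * s) ∧ 0 ≤ σ ∧ σ ≤ 7176 * (ℓ ^ 4 * X₀ * Y * n * s) ∧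
      (2 * ℓ * cstar ≤ σ ∧ 2 * ℓ * a ≤ σ) ∧ 0 ≤ δ ∧ δ ≤ 287040 * (ℓ ^ 4 * X₀ * Y * n * s) ∧ 0 ≤ ω ∧ ω ≤ 6 * 10 ^ 8 * ℓ * (ℓ ^ 4 * X₀ * Y * n * s) ∧
      0 < τ₀ ∧ τ₀ = 32 * ℓ * m * (cstar + a) ∧ τ₀ ≤ 344448 * (ℓ ^ 4 * X₀ * Y * n * s) ∧
      2 * (ℓ * cstar) + 8 * α₄ ≤ 4 * 10 ^ 9 * (ℓ ^ 4 * X₀ * Y * n * s) ∧ ε₀ + 120 * cB + 8 * α₄ ≤ 4 * 10 ^ 9 * (ℓ ^ 4 * X₀ * Y * n * s) ∧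
      0 ≤ Cl ∧ Cl ≤ 10 ^ 18 * ℓ ^ 2 * (ℓ ^ 4 * X₀ * Y * n * s) ∧ 0 ≤ Cb₂ ∧ Cb₂ ≤ 4 * 10 ^ 21 * ℓ ^ 2 * (ℓ ^ 4 * X₀ * Y * n * s) ^ 2 ∧
      Cb₂ = 960 * ℓ * (α₄ + δ + 5 * ω) * α₄ ∧ α₄ + δ + 11 * ω ≤ 8 * 10 ^ 9 * ℓ * (ℓ ^ 4 * X₀ * Y * n * s) ∧
      BG * BR * cDA ≤ α₄ / 40 ∧ (∀ τ : ℝ, τ ≤ τ₀ → BG * BR * (B₂' * τ) ≤ α₄ / 150) ∧ 32 * ℓ * m * B₀'H * (cstar + a) < α₄ / 4 ∧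
      s ≤ ℓ ^ 4 * X₀ * Y * n * s ∧ cB ≤ 3390 * (ℓ ^ 4 * X₀ * Y * n * s) ∧ cDA ≤ 10170 * (ℓ ^ 4 * X₀ * Y * n * s) := by
  have hℓ0 : 0 ≤ ℓ := by linarith only [hℓ1]
  have hX₀0 : 0 ≤ X₀ := by linarith only [hX₀1]
  have hY0 : 0 ≤ Y := by linarith only [hY1]
  have hm0 : 0 ≤ m := by linarith only [hm1]
  have hn0 : 0 ≤ n := by linarith only [hn1]
  have hBGBR : 0 ≤ BG * BR := mul_nonneg hBG hBR
  set V₄ : ℝ := ℓ ^ 4 * X₀ * Y * n * s with hV₄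
  have hV₄0 : 0 ≤ V₄ := by positivity
  -- units
  have hunit : ℓ * X₀ * s ≤ ℓ ^ 4 * X₀ * Y * n * s := by
    have h : ℓ ^ 1 * X₀ * 1 * 1 * s ≤ ℓ ^ 4 * X₀ * Y * n * s := by gcongr; norm_num
    linarith only [h]
  have hunit2 : ℓ ^ 2 * X₀ * s ≤ V₄ := by
    have h : ℓ ^ 2 * X₀ * 1 * 1 * s ≤ ℓ ^ 4 * X₀ * Y * n * s := by gcongr; norm_num
    rw [hV₄]; linarith only [h]
  have hunit3 : ℓ ^ 3 * X₀ * s ≤ V₄ := by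
    have h : ℓ ^ 3 * X₀ * 1 * 1 * s ≤ ℓ ^ 4 * X₀ * Y * n * s := by gcongr; norm_num
    rw [hV₄]; linarith only [h]
  have hunit0 : s ≤ V₄ := by
    have h : (1 : ℝ) ≤ ℓ ^ 4 * X₀ * Y * n := by
      calc (1 : ℝ) = 1 * 1 * 1 * 1 := by ring
        _ ≤ ℓ ^ 4 * X₀ * Y * n := by gcongr; exact one_le_pow₀ hℓ1
    have := mul_le_mul_of_nonneg_right h hs0.le
    rw [hV₄]; linarith only [this]
  -- `B₀'`, `α₄`
  have hℓm1 : 1 ≤ ℓ * m := one_le_mul_of_one_le_of_one_le hℓ1 hm1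
  have hB₀'0 : 0 < B₀' := by rw [hB₀']; positivity
  have hB₀'L1 : B₀'H ≤ B₀' := by
    rw [hB₀']
    have e := mul_le_mul (by linarith only [hℓm1] : (1 : ℝ) ≤ 300 * ℓ * m) hbL1 hB₀'H.le (by positivity)
    linarith only [e]
  have hα₄0 : 0 < α₄ := by rw [hα₄]; positivity
  have hα₄E : α₄ = 2400 * ℓ * m * B₀'b * cstar := by rw [hα₄, hB₀']; ring
  have hα₄U : α₄ ≤ 4 * 10 ^ 8 * V₄ := by
    rw [hα₄E]
    have e1 : ℓ * m * B₀'b * cstar ≤ ℓ * (3 * n) * (15 * ℓ ^ 2 * Y) * (3390 * ℓ * X₀ * s) :=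
      mul_le_mul (mul_le_mul (mul_le_mul_of_nonneg_left hm3 hℓ0) hbU hb0.le (by positivity)) hcsU hcs0.le (by positivity)
    have e2 : ℓ * (3 * n) * (15 * ℓ ^ 2 * Y) * (3390 * ℓ * X₀ * s) = 152550 * V₄ := by rw [hV₄]; ring
    linarith only [e1, e2, hV₄0]
  -- `σ`, `δ`, `ω`, `τ₀`
  have ha2 : 2 * a ≤ cstar := by linarith only [haU, hcsL, hs0]
  have hℓs : ℓ * s ≤ V₄ := by
    have : ℓ ^ 1 * 1 * 1 * 1 * s ≤ ℓ ^ 4 * X₀ * Y * n * s := by gcongr; norm_num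
    rw [hV₄]; linarith only [this]
  have hℓ2s : ℓ ^ 2 * s ≤ V₄ := by
    have : ℓ ^ 2 * 1 * 1 * 1 * s ≤ ℓ ^ 4 * X₀ * Y * n * s := by gcongr; norm_num
    rw [hV₄]; linarith only [this]
  have hσ0 : 0 ≤ σ := by rw [hσ]; positivity
  have hσU : σ ≤ 7176 * V₄ := by
    rw [hσ]
    have e := mul_le_mul_of_nonneg_left hcsU hℓ0
    have e' := mul_le_mul_of_nonneg_left haU hℓ0
    linarith only [e, e', hunit2, hℓs]
  have hσL : 2 * ℓ * cstar ≤ σ := by rw [hσ]; nlinarith only [ha0, hℓ0]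
  have hσLa : 2 * ℓ * a ≤ σ := by rw [hσ]; nlinarith only [hcs0, hℓ0]
  have hδ0 : 0 ≤ δ := by rw [hδ]; positivity
  have hδU : δ ≤ 287040 * V₄ := by
    rw [hδ, hσ]
    have e := mul_le_mul_of_nonneg_left hcsU (by positivity : (0 : ℝ) ≤ ℓ ^ 2)
    have e' := mul_le_mul_of_nonneg_left haU (by positivity : (0 : ℝ) ≤ ℓ ^ 2)
    linarith only [e, e', hunit3, hℓ2s]
  have hω0 : 0 ≤ ω := by rw [hω]; positivity
  have hωU : ω ≤ 6 * 10 ^ 8 * ℓ * V₄ := by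
    rw [hω]; have e := mul_le_mul_of_nonneg_left hα₄U hℓ0; linarith only [e]
  have hτ₀E : τ₀ = 32 * ℓ * m * (cstar + a) := by rw [hτ₀, hσ]; ring
  have hτ₀0 : 0 < τ₀ := by rw [hτ₀E]; positivity
  have hcsaU : cstar + a ≤ 3588 * ℓ * X₀ * s := by
    have : s ≤ ℓ * X₀ * s := by
      have := mul_nonneg (sub_nonneg.mpr (one_le_mul_of_one_le_of_one_le hℓ1 hX₀1)) hs0.le; linarith only [this]
    linarith only [hcsU, haU, this]
  have hτ₀U : τ₀ ≤ 344448 * V₄ := by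
    rw [hτ₀E]
    have e1 : ℓ * m * (cstar + a) ≤ ℓ * (3 * n) * (3588 * ℓ * X₀ * s) := mul_le_mul (mul_le_mul_of_nonneg_left hm3 hℓ0) hcsaU (by positivity) (by positivity)
    have e2 : ℓ * (3 * n) * (3588 * ℓ * X₀ * s) = 10764 * (ℓ ^ 2 * X₀ * 1 * n * s) := by ring
    have e3 : ℓ ^ 2 * X₀ * 1 * n * s ≤ ℓ ^ 4 * X₀ * Y * n * s := by gcongr; norm_num
    linarith only [e1, e2, e3]
  -- `cB`, `cDA`, `t`, `Q`
  have hcB0 : 0 ≤ cB := by rw [hcB]; positivity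
  have hcBU : cB ≤ 3390 * V₄ := by rw [hcB]; have e := mul_le_mul_of_nonneg_left hcsU hℓ0; linarith only [e, hunit2]
  have hcDAU : cDA ≤ 10170 * V₄ := by
    rw [hcDA]; have e := mul_le_mul_of_nonneg_left hcsU (by positivity : (0 : ℝ) ≤ ℓ ^ 2); linarith only [e, hunit3]
  have htU : 2 * (ℓ * cstar) + 8 * α₄ ≤ 4 * 10 ^ 9 * V₄ := by rw [← hcB]; linarith only [hcBU, hα₄U, hV₄0]
  have hQU : ε₀ + 120 * cB + 8 * α₄ ≤ 4 * 10 ^ 9 * V₄ := by linarith only [hεs, hunit0, hcBU, hα₄U, hV₄0]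
  -- `Cl`, `Cb₂`
  have hℓV : V₄ ≤ ℓ * V₄ := by have := mul_le_mul_of_nonneg_right hℓ1 hV₄0; linarith only [this]
  have hsum : α₄ + δ + 11 * ω ≤ 8 * 10 ^ 9 * ℓ * V₄ := by
    linarith only [hα₄U, hδU, hωU, hℓV, hV₄0]
  have hsum0 : 0 ≤ α₄ + δ + 11 * ω := by positivity
  have hCl0 : 0 ≤ Cl := by rw [hCl]; positivity
  have hClU : Cl ≤ 10 ^ 18 * ℓ ^ 2 * V₄ := by
    rw [hCl]
    have e1 := mul_le_mul_of_nonneg_left hsum (by positivity : (0 : ℝ) ≤ 10240 * (3 * ℓ))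
    have e2 : V₄ ≤ ℓ ^ 2 * V₄ := by
      have := mul_le_mul_of_nonneg_right (one_le_pow₀ hℓ1 : (1 : ℝ) ≤ ℓ ^ 2) hV₄0; linarith only [this]
    linarith only [hcBU, hα₄U, e1, e2, hV₄0, hℓV]
  have hCb₂E : Cb₂ = 960 * ℓ * (α₄ + δ + 5 * ω) * α₄ := by rw [hCb₂, hω]; ring
  have hCb₂0 : 0 ≤ Cb₂ := by rw [hCb₂]; positivity
  have hCb₂U : Cb₂ ≤ 4 * 10 ^ 21 * ℓ ^ 2 * V₄ ^ 2 := by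
    rw [hCb₂E]
    have e0 : α₄ + δ + 5 * ω ≤ 8 * 10 ^ 9 * ℓ * V₄ := by linarith only [hsum, hω0]
    have e1 : 960 * ℓ * (α₄ + δ + 5 * ω) * α₄ ≤ 960 * ℓ * (8 * 10 ^ 9 * ℓ * V₄) * (4 * 10 ^ 8 * V₄) := by gcongr
    have p : 0 ≤ ℓ ^ 2 * V₄ ^ 2 := by positivity
    linarith only [e1, p]
  -- the structural shares of (1.103)
  have hsh1 : BG * BR * cDA ≤ α₄ / 40 := by
    rw [hcDA, hα₄E, le_div_iff₀ (by norm_num : (0 : ℝ) < 40)]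
    have e1 := mul_le_mul_of_nonneg_left (mul_le_mul_of_nonneg_right hbL2 hcs0.le) (by positivity : (0 : ℝ) ≤ ℓ * m)
    have e2 : ℓ ^ 2 * BG * BR * cstar ≤ ℓ * m * (ℓ ^ 2 * BG * BR * cstar) := by
      have := mul_le_mul_of_nonneg_right hℓm1 (by positivity : (0 : ℝ) ≤ ℓ ^ 2 * BG * BR * cstar); linarith only [this]
    have p : 0 ≤ ℓ * m * B₀'b * cstar := by positivity
    linarith only [e1, e2, p]
  have hsh2 : ∀ τ : ℝ, τ ≤ τ₀ → BG * BR * (B₂' * τ) ≤ α₄ / 150 := by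
    intro τ hτ
    rw [hα₄E, le_div_iff₀ (by norm_num : (0 : ℝ) < 150)]
    have hBGBRB : 0 ≤ BG * BR * B₂' := mul_nonneg hBGBR hB₂'
    have e1 := mul_le_mul_of_nonneg_left (hτ.trans (le_of_eq hτ₀E)) hBGBRB
    have e2 := mul_le_mul_of_nonneg_right hbL3 (by positivity : (0 : ℝ) ≤ ℓ * m * cstar)
    have e3 := mul_le_mul_of_nonneg_left ha2 (by positivity : (0 : ℝ) ≤ ℓ * m * (BG * BR * B₂'))
    have p : 0 ≤ ℓ * m * B₀'b * cstar := by positivity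
    linarith only [e1, e2, e3, p]
  have hsh3 : 32 * ℓ * m * B₀'H * (cstar + a) < α₄ / 4 := by
    rw [hα₄E, lt_div_iff₀ (by norm_num : (0 : ℝ) < 4)]
    have e := mul_le_mul_of_nonneg_right hbL1 (by positivity : (0 : ℝ) ≤ ℓ * m * cstar)
    have e3 := mul_le_mul_of_nonneg_left ha2 (by positivity : (0 : ℝ) ≤ ℓ * m * B₀'H)
    have p : 0 < ℓ * m * B₀'H * cstar := by positivity
    nlinarith only [e, e3, p]
  refine ⟨hB₀'0, hB₀'L1, hα₄0, hα₄U, hσ0, hσU, ⟨hσL, hσLa⟩, hδ0, hδU, hω0, hωU, hτ₀0, hτ₀E, hτ₀U, htU, hQU, hCl0, hClU, hCb₂0, hCb₂U, hCb₂E, hsum,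
    hsh1, hsh2, hsh3, hunit0, hcBU, hcDAU⟩

end Summit.QuantumFields.YangMills.Theorems.HalvingHSupURhoWindowsRho3Prelim

end
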